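import Summits.QuantumFields.YangMills.Theorems.BalabanUVNodesN22W1StripLemma3
import Literature.MathematicalPhysics.QuantumFieldTheory.Balaban1983to89.B8SectDSource

/-!
# BalabanUVNodes ∕ node N22 = NE9 — THE W1 OBJECT's «(1.17) ‖E′‖ ON U^c_k» (FAN-OUT §N22 s1, second half of the row): the configuration-derivative
# bound `W1.TermDerivBound` PRODUCED from (1.18) on the larger space + analyticity in (𝐔,𝐉) + the margin of [I] p. 263, by Cauchy's estimate in a
# complex Banach space (`B8SectDSource.norm_fderiv_le_of_norm_le` BY NAME); and END TO END from the level-T strip hypothesis of module 3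

Cell `pub-ymgap`, HUMAN RULING D-0062 (Track A), R134 ACCELERATION re-seat `pub-ymgap-dag-n22-c` (strategy s1; FAN-OUT v1.1 §N22 s1 «THE HISTORY-LIPSCHITZ
OBJECT W1 … + (1.17) ‖E′‖ on U^c_k (object-bound)»), generation 2, module 6.  THEOREMS ONLY; imports module 3 `…N22W1StripLemma3` (p465262; through it
modules 1–2 and the W1 OBJECT p455641: `TermAnalytic`, `TermBound118`, `DerivBoundOn`, `TermDerivBound`) and `B8SectDSource` ([Balaban1985RegularSpaces]
(1.105): the Banach-space Cauchy estimate `norm_fderiv_le_of_norm_le`) BY NAME.  `--supports` the K3′ item of route `BalabanUVNodes`.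

WHY.  The W1 object types the configuration-derivative bound `‖∂_{(𝐔,𝐉)} E^{(j)}(X; g; ·)‖ ≤ E₁e^{−r d_j(X)}` on a space table (`TermDerivBound`, marked
NOT PRINTED as a display) and says what it is: «what (1.18) + analyticity give by Cauchy on the margin of p. 263» — [I] p. 263: the configurations
satisfying (i)–(iii) with SMALLER constants `α′₀, α′₁` lie inside `U^c_j(X, α₀, α₁)`.  No producer existed.  THIS FILE is that producer: for two space
tables `sp′ ⊆ sp` with a MARGIN `ρ` (every `φ ∈ sp′ j X` has its `ρ`-ball — sup-norm on the bond variables of `Φ = (PBond → 𝔸)²` — inside `sp j X`;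
DISPLAYED: the located reading of p. 263's sentence, Theorem-1∕space content), analyticity of the terms on `sp` (`TermAnalytic`, [I] p. 263 ∕ [II] (2.13an),
print's inductive «by assertion» clause) and (1.18) on `sp` (`TermBound118` — itself a COROLLARY of the strip induction, modules 1∕3) give `TermDerivBound` on
`sp′` with `E₁ = E₀∕ρ`: restrict to complex lines and apply Cauchy (the tree's kernel form `B8SectDSource.norm_fderiv_le_of_norm_le`, translated to a
ball about `φ`).

WHAT.
* §1 `norm_fderiv_le_of_ball` — ENGINE (pure complex analysis in a normed ℂ-space): `f` differentiable on `ball φ ρ` (`ρ > 0`) with `‖f‖ ≤ B` there ⟹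
  `‖fderiv ℂ f φ‖ ≤ B∕ρ` (`norm_fderiv_le_of_norm_le` at the translate `x ↦ f (x + φ)`, `fderiv_comp_add_right`).
* §2 `termDerivBound_of_termBound118` — **(1.17) AT THE OBJECT**: margin `ρ` + `TermAnalytic S W sp` + `TermBound118 S W sp E₀ r` ⟹
  `TermDerivBound S W sp′ (E₀∕ρ) r`; `derivBoundOn_termC_of_ball` — the per-`(g, j, X)` form.
* §3 `termDerivBound_of_termwise226Strip` — END TO END: the level-T strip hypothesis (module 3) + numerals + `TermAnalytic` on `sp` + margin ⟹ `TermDerivBound` on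
  `sp′` with `E₁ = E₀∕ρ`, rate `κ`.

HONEST FRAMING.  Count-neutral by-name knit AT THE OBJECT; NOT a discharge of N22 (nor of N18, the natural consumer of ‖E′‖).  DISPLAYED and asserted
nowhere: the margin (p. 263's smaller-constants sentence read as a `ρ`-ball inclusion between two space tables — a statement about `Sect2.spaceI` the definer
lane may prove; here a hypothesis), `TermAnalytic` (print's inductive analyticity, by assertion), and — in §3 — the level-T strip hypothesis (modules 1–3
HONEST FRAMING verbatim).  One finite four-torus programme at fixed ε — NOT infinite volume, NOT OS on ℝ⁴, NOT a mass gap, NOT Clay.  0 `sorry`, 0 `def`,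
standard axioms.

References (TYPES only): [I] = [Balaban1987RG1] T. Bałaban, Commun. Math. Phys. **109** (1987) 249–301 — (1.17)–(1.18) and the sentence before (1.18),
p. 263; [Balaban1985RegularSpaces] T. Bałaban, Commun. Math. Phys. **99** (1985) 75–102 — (1.105) p. 94 (Cauchy formula for the derivative); [II] =
[Balaban1988RG2Cluster] (2.13an) p. 15.
-/

noncomputable section

namespace YMDAG.N22.W1

open Set Metric
open scoped BigOperators
open Literature.MathematicalPhysics.QuantumFieldTheory.Balaban1983to89
open Literature.MathematicalPhysics.QuantumFieldTheory.Balaban1983to89.T4Continuum (T4Family)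
open Literature.MathematicalPhysics.QuantumFieldTheory.Balaban1983to89.T4OutputRate
open Literature.MathematicalPhysics.QuantumFieldTheory.Balaban1983to89.TreeLengthTorus (TPt TDom tsys torusTreeLen torusTreeLen_nonneg)
open Literature.MathematicalPhysics.QuantumFieldTheory.Balaban1983to89.B12TreeDecay (K₀ K₀_pos)
open Literature.MathematicalPhysics.QuantumFieldTheory.Balaban1983to89.B13Lemma3TorusData (TBond)
open Literature.MathematicalPhysics.QuantumFieldTheory.Balaban1983to89.B13Lemma3TorusTerms (terms weight)
open Literature.MathematicalPhysics.QuantumFieldTheory.Balaban1983to89.B13Lemma3TorusSocket (Lemma3Numerics)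
open Literature.MathematicalPhysics.QuantumFieldTheory.Balaban1983to89.B8SectDSource (norm_fderiv_le_of_norm_le)
open Literature.MathematicalPhysics.QuantumFieldTheory.Balaban1983to89.Node00
open Literature.MathematicalPhysics.QuantumFieldTheory.Balaban1983to89.Node00.Sect2 (domSys domCount CPair ofBackgroundC)
open Literature.MathematicalPhysics.QuantumFieldTheory.Balaban1983to89.Node00.W1

/-! ## §1 Cauchy's estimate on a ball of a complex normed space -/

/-- **CAUCHY's ESTIMATE ON A BALL** (engine): in a complex normed space, a function complex-differentiable on the open ball `ball φ ρ` (`ρ > 0`) and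
bounded by `B` there has `‖fderiv ℂ f φ‖ ≤ B∕ρ` — the tree's `B8SectDSource.norm_fderiv_le_of_norm_le` ([Balaban1985RegularSpaces] (1.105), balls about
`0`) at the translate `x ↦ f (x + φ)` (`fderiv_comp_add_right`). [cite: Balaban1985RegularSpaces, (1.105) p.94] -/
theorem norm_fderiv_le_of_ball {E : Type*} [NormedAddCommGroup E] [NormedSpace ℂ E] {f : E → ℂ} {φ : E} {ρ B : ℝ} (hρ : 0 < ρ)
    (hd : DifferentiableOn ℂ f (ball φ ρ)) (hB : ∀ ψ ∈ ball φ ρ, ‖f ψ‖ ≤ B) : ‖fderiv ℂ f φ‖ ≤ B / ρ := by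
  have hmaps : MapsTo (fun x : E => x + φ) (ball (0 : E) ρ) (ball φ ρ) := by
    intro x hx
    rw [mem_ball, dist_eq_norm, add_sub_cancel_right]
    exact mem_ball_zero_iff.1 hx
  have hdΦ : DifferentiableOn ℂ (fun x : E => f (x + φ)) (ball (0 : E) ρ) :=
    hd.comp ((differentiable_id.add_const φ).differentiableOn) hmaps
  have hMΦ : ∀ x ∈ ball (0 : E) ρ, ‖f (x + φ)‖ ≤ B := fun x hx => hB _ (hmaps hx)
  have h := norm_fderiv_le_of_norm_le (Φ := fun x : E => f (x + φ)) hdΦ hMΦ (x := 0) (by rw [norm_zero]; exact hρ)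
  rw [fderiv_comp_add_right, zero_add, norm_zero, sub_zero] at h
  exact h

/-! ## §2 (1.17) at the W1 object: the derivative bound on the smaller space table -/

section Deriv

variable {𝔸 : Type*} [NormedRing 𝔸] [NormedAlgebra ℂ 𝔸] {P : Params} {M : ℕ}

/-- **THE PER-TERM FORM**: if `ball φ ρ ⊆ sp j X` for every `φ ∈ sp′ j X` (margin), `E^{(j)}(X; g; ·)` is analytic on `sp j X` and bounded there by
`E₀e^{−r d_j(X)}`, then on `sp′ j X` it is differentiable with `‖∂_{(𝐔,𝐉)} E^{(j)}(X; g; ·)‖ ≤ (E₀∕ρ)·e^{−r d_j(X)}` — `W1.DerivBoundOn`.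
[cite: Balaban1987RG1, §1 p.263 (the smaller space inside U^c_j) with (1.18)] -/
theorem derivBoundOn_termC_of_ball (S : ClusterTower P 𝔸 M) {j : ℕ} (X : (domSys P M j).Dom) (g : ℕ → ℝ) {s s' : Set (CPair P 𝔸)}
    {E₀ r ρ : ℝ} (hρ : 0 < ρ) (hmargin : ∀ φ ∈ s', ball φ ρ ⊆ s) (han : AnalyticOnNhd ℂ (termC S j X g) s)
    (hB : ∀ ψ ∈ s, ‖termC S j X g ψ‖ ≤ E₀ * Real.exp (-(r * (domSys P M j).dj X))) :
    DerivBoundOn (termC S j X g) s' (E₀ / ρ * Real.exp (-(r * (domSys P M j).dj X))) := by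
  intro φ hφ
  have hball := hmargin φ hφ
  refine ⟨(han φ (hball (mem_ball_self hρ))).differentiableAt, ?_⟩
  have h := norm_fderiv_le_of_ball hρ ((han.mono hball).differentiableOn) fun ψ hψ => hB ψ (hball hψ)
  calc ‖fderiv ℂ (termC S j X g) φ‖ ≤ E₀ * Real.exp (-(r * (domSys P M j).dj X)) / ρ := h
    _ = E₀ / ρ * Real.exp (-(r * (domSys P M j).dj X)) := by ring

/-- **(1.17) AT THE W1 OBJECT — `W1.TermDerivBound` PRODUCED.**  Two space tables `sp′`, `sp` with a MARGIN `ρ > 0` (`ball φ ρ ⊆ sp j X` for every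
`φ ∈ sp′ j X` — [I] p. 263: configurations obeying (i)–(iii) with smaller `α′₀, α′₁` lie in `U^c_j(X, α₀, α₁)`; DISPLAYED), analyticity of every term on
`sp` (`W1.TermAnalytic S W sp`, [I] p. 263 ∕ [II] (2.13an)) and (1.18) on `sp` (`W1.TermBound118 S W sp E₀ r`) give the configuration-derivative bound on
`sp′` with `E₁ = E₀∕ρ`: `W1.TermDerivBound S W sp′ (E₀∕ρ) r` — §1 term by term. [cite: Balaban1987RG1, §1 p.263 ((1.17)–(1.18) and the sentence before (1.18))] -/
theorem termDerivBound_of_termBound118 (S : ClusterTower P 𝔸 M) (W : Set (ℕ → ℝ))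
    (sp sp' : (j : ℕ) → (domSys P M j).Dom → Set (CPair P 𝔸)) {E₀ r ρ : ℝ} (hρ : 0 < ρ)
    (hmargin : ∀ (j : ℕ) (X : (domSys P M j).Dom), ∀ φ ∈ sp' j X, ball φ ρ ⊆ sp j X)
    (han : TermAnalytic S W sp) (h118 : TermBound118 S W sp E₀ r) :
    TermDerivBound S W sp' (E₀ / ρ) r := fun g hg j X =>
  derivBoundOn_termC_of_ball S X g hρ (hmargin j X) (han g hg j X) (fun ψ hψ => h118 g hg j X ψ hψ)

end Deriv

/-! ## §3 End to end from the level-T strip hypothesis (module 3) -/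

section EndToEnd

variable (F : T4Family) (K : ℕ) {𝔸 : Type*} [NormedRing 𝔸] [NormedAlgebra ℂ 𝔸] {M : ℕ}

open Classical in
/-- **LEVEL T ⟹ (1.17) AT THE OBJECT**: the displayed level-T strip hypothesis on the space table `sp` + the numerals (module 3's
`termBound118_of_termwise226Strip` gives (1.18) on `sp`) + analyticity of the terms on `sp` + the margin `ρ` of `sp′` inside `sp` ⟹
`W1.TermDerivBound S (Window γ) sp′ (E₀∕ρ) κ`. [cite: Balaban1987RG1, §1 p.263 ((1.17)–(1.18))] -/
theorem termDerivBound_of_termwise226Strip [NeZero M] (S : ClusterTower (F.P K) 𝔸 M)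
    (sp sp' : (j : ℕ) → (domSys (F.P K) M j).Dom → Set (CPair (F.P K) 𝔸)) {ρ : ℝ} (hρ : 0 < ρ)
    (hmargin : ∀ (j : ℕ) (X : (domSys (F.P K) M j).Dom), ∀ φ ∈ sp' j X, ball φ ρ ⊆ sp j X) (c : B13.Consts) {L : ℕ} [NeZero L]
    (hL : 8 ≤ c.L) (hLc : c.L = L) {a a₂ a₂' a₅ Aabs : ℝ} (hN : Lemma3Numerics c M ((c.L : ℝ) / 2) a a₂ a₂' a₅ Aabs)
    {γ r E₀ κ r₁ : ℝ} (hr : 0 ≤ r) (hA0 : 0 ≤ c.C3act * c.ε₁) (hr₁ : 0 ≤ r₁) (hκ : κ ≤ r₁)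
    (hrate : r₁ + 2 * (64 * Real.log 162) + 2 ≤ (1 - 8 * c.δ) * ((c.L : ℝ) / 2) * c.κ)
    (hsmall : c.C3act * c.ε₁ * Real.exp (5 * r₁ + 1) * K₀ 64 8 * 9 * 64 ≤ 1)
    (hrenew : Real.exp 1 * 9 * 64 * K₀ 64 8 ^ 2 * (c.C3act * c.ε₁) ≤ E₀) (han : TermAnalytic S (Window γ) sp)
    (h226T : ∀ (k : ℕ) (g : ℕ → ℝ), g ∈ Window γ → ∀ (i : ℕ), i < k + 1 → ∀ (X : (domSys (F.P K) M (k + 1)).Dom) (φ : CPair (F.P K) 𝔸),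
      φ ∈ sp (k + 1) X →
      (∀ (j : ℕ), j < k + 1 → ∀ (Y : (domSys (F.P K) M j).Dom) (ψ : CPair (F.P K) 𝔸), ψ ∈ sp j Y →
        ∃ (Ec : ℂ → ℂ) (O : Set ℂ), IsOpen O ∧ (∀ t ∈ Ioc (0 : ℝ) γ, closedBall (t : ℂ) r ⊆ O) ∧ DifferentiableOn ℂ Ec O ∧
          (∀ z ∈ O, ‖Ec z‖ ≤ E₀ * Real.exp (-(κ * torusTreeLen Y.1))) ∧
          (∀ t ∈ Ioc (0 : ℝ) γ, Ec t = termC S j Y (Function.update g i t) ψ)) →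
      ∃ (Hc : ℂ → TDom 4 (domCount (F.P K) M (k + 1)) → ℂ)
        (Tt : (Z : TDom 4 (domCount (F.P K) M (k + 1))) →
          Finset (TDom 4 (L * domCount (F.P K) M (k + 1))) × Finset (TBond 4 M (L * domCount (F.P K) M (k + 1))) → ℂ → ℂ)
        (O : Set ℂ), IsOpen O ∧ (∀ t ∈ Ioc (0 : ℝ) γ, closedBall (t : ℂ) r ⊆ O) ∧
        (∀ Z : (domSys (F.P K) M (k + 1)).Dom, Z.1 ⊆ X.1 → DifferentiableOn ℂ (fun z => Hc z Z) O) ∧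
        (∀ z ∈ O, ∀ Z : TDom 4 (domCount (F.P K) M (k + 1)), Z.1 ⊆ X.1 → ‖Hc z Z‖ ≤ ∑ t ∈ terms L M Z, ‖Tt Z t z‖) ∧
        (∀ z ∈ O, ∀ Z : TDom 4 (domCount (F.P K) M (k + 1)), Z.1 ⊆ X.1 → ∀ t ∈ terms L M Z,
          ‖Tt Z t z‖ ≤ weight L M c Z a t * Real.exp (a₅ * ((Z.1).card : ℝ))) ∧
        (∀ t ∈ Ioc (0 : ℝ) γ, Hc t = (S k).H (restrictPrefix k (Function.update g i t)) φ)) :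
    TermDerivBound S (Window γ) sp' (E₀ / ρ) κ :=
  termDerivBound_of_termBound118 S (Window γ) sp sp' hρ hmargin han
    (termBound118_of_termwise226Strip F K S sp c hL hLc hN hr hA0 hr₁ hκ hrate hsmall hrenew h226T)

end EndToEnd

end YMDAG.N22.W1

end
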